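import Summits.ABC.IUTFork.Cor312VolumesArchSummands
import Summits.ABC.IUTFork.Cor312VolumesPadicLattice
import HarnessLib

/-!
# [IUTchIII] Corollary 3.12, statement — the scaled integral structures `r·B_I` of the real ARCHIMEDEAN packets:
# (Ind1)/(Ind2) descend along the comparison to bijections FIXING them; boundedness; absorption

Record-only file (D-0012) of the abc-iut cell (wave-5 prover seat abc-iut-w5-d163 gen 2; TEAM A row A-0 NAMED
LEFTOVER (4) «archimedean radial container vs DH convention», sequel of `Cor312VolumesArchSummands`); TAKES NO
SIDE. The archimedean twin of abc-iut-c312-5's `Cor312VolumesPadicLattice` (the log-shell LATTICES `Π_{v⃗} c·I_{v⃗}`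
of the real prime packets, fixed by every (Ind1)/(Ind2)-family — the stable set `W` of c312-7's
`hullDefined_of_stable`, i.e. the "compactness of the `^{1,∘}𝒰_{j,v_ℚ}`" of the opening paragraph of the proof
of [IUTchIII] Cor. 3.12, kurims `paper:url-4b091feeb646` p. 175 l. 2–4). AT `v_ℚ = ∞` the stable bounded
absorbing family is the family of SCALED INTEGRAL STRUCTURES `r·B_I` (`r > 0`) of the real archimedean packet
`M_I = ⊗_ℝ (⊕_{v|∞} ℂ_v)` ([IUTchIV] Prop. 1.5 (iii); Step (vii) p. 30: "the indeterminacies (Ind1) and (Ind2) are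
taken into account by the fact that `B_I ⊆ M_I` is preserved by arbitrary automorphisms of the type discussed in
Proposition 1.5, (iii)"). For an archimedean presentation `P : ArchPresentation L v_ℚ`:

* `ballPk r = e⁻¹(r·B_I)` in the algebraic packet `𝓘^ℚ(^{S^±_{j+1}};𝒟^⊢_∞)`;
* DESCENT: `comparison_permute` / `comparison_factorwise` (the explicit maps behind p417640's
  `GeneratorsPreserve`: re-indexing `reindexEquiv σ`, L5-t7's induced automorphism `induced τ`), and these
  bijections map `r·B_I` ONTO itself (`reindexEquiv_image_smul_ball` via `preservesDecomposition_reindex`;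
  `induced_image_smul_ball` via L5-t7 `image_ball_induced`); hence EVERY (Ind1)- or (Ind2)-family of c312-1 maps
  `ballPk r` onto itself (`family_image_ballPk`, `image_ballPk_of_mem_closure`);
* BOUNDS/ABSORPTION in the field-factor coordinates `Φ₀ ∘ e`: `(Φ₀ ∘ e)(ballPk r) = ` the polydisc of common radius
  `r` (`factorCoords_image_ballPk`), and every bounded family in `⊕_{(w,ε)} ℂ` lies in such a polydisc
  (`exists_polydisc_of_isBounded`), so `e⁻¹(Φ₀⁻¹ S) ⊆ ballPk r` (`preimage_subset_ballPk_of_isBounded`).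
[claim: Mochizuki2012, status: disputed] for the quoted sentences; classical otherwise (pure set algebra over
p417640 and abc-iut-L5-t7's theorems). Deliberately NOT here: `HullDefined` for a setting (companion over
`Real.settingDHVolArch`), Θ-boxes, any judgement.
-/

noncomputable section

open Set Function PiTensorProduct MeasureTheory Bornology
open scoped TensorProduct Pointwise

namespace Summit.ABC

namespace IUTFork

namespace Cor312Vol

namespace ArchPresentation

open Thm311 Literature.IUT.LogThetaLattice Literature.IUT.LogVolume Literature.IUT.LogVolume.Prop15iii
  Literature.IUT.LogVolume.ArchPacket

attribute [local instance] fibreFintype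

variable {T : ThetaIndex} {L : LogShells T} {vQ : T.VQ} (P : ArchPresentation L vQ) {j : T.Label}

/-! ## 1. The scaled integral structures and their preimages -/

/-- The preimage `e⁻¹(r·B_I)` of the scaled integral structure in the algebraic packet `𝓘^ℚ(^{S^±_{j+1}};𝒟^⊢_∞)` —
the stable set `W` at the archimedean place. [claim: Mochizuki2012, status: disputed] -/
def ballPk (j : T.Label) (r : ℝ) : Set (L.Packet j vQ) := P.comparison j ⁻¹' (r • ball (Φ₀ vQ j))

/-- The field-factor coordinates `Φ₀ ∘ e : 𝓘^ℚ(^{S^±_{j+1}};𝒟^⊢_∞) → ⊕_{(w,ε)} ℂ`. [claim: Mochizuki2012, status: disputed] -/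
def factorCoords (j : T.Label) (x : L.Packet j vQ) : J vQ j → ℂ :=
  (Φ₀ vQ j : X vQ j → (J vQ j → ℂ)) (P.comparison j x)

/-- `Φ₀ ∘ e` is onto. [folklore] -/
theorem factorCoords_surjective (j : T.Label) :
    Function.Surjective (Cor312Vol.ArchPresentation.factorCoords P j) :=
  (Φ₀ vQ j).surjective.comp (P.comparison_surjective j)

/-- `Φ₀(r·B_I)` is the polydisc of common radius `r ≥ 0`. [claim: Mochizuki2012, status: disputed] -/
theorem image_Φ₀_smul_ball (j : T.Label) {r : ℝ} (hr : 0 ≤ r) :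
    (Φ₀ vQ j : X vQ j → (J vQ j → ℂ)) '' (r • ball (Φ₀ vQ j)) = polydisc (J vQ j) fun _ => r := by
  rw [Prop15iii.image_smul_eq, image_ball, smul_unitBall (J vQ j) hr]

/-- `ballPk r` in field-factor coordinates is the preimage of the polydisc of common radius `r`. [folklore] -/
theorem ballPk_eq_preimage_polydisc (j : T.Label) {r : ℝ} (hr : 0 ≤ r) :
    P.ballPk j r = P.factorCoords j ⁻¹' polydisc (J vQ j) fun _ => r := by
  ext x
  simp only [ballPk, factorCoords, Set.mem_preimage]
  rw [← image_Φ₀_smul_ball j hr, (Φ₀ vQ j).injective.mem_set_image]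

/-- **`(Φ₀ ∘ e)(ballPk r)` IS the polydisc of common radius `r`** — in particular bounded. [folklore] -/
theorem factorCoords_image_ballPk (j : T.Label) {r : ℝ} (hr : 0 ≤ r) :
    P.factorCoords j '' P.ballPk j r = polydisc (J vQ j) fun _ => r := by
  rw [ballPk_eq_preimage_polydisc P j hr]
  exact Set.image_preimage_eq _ (P.factorCoords_surjective j)

/-- `(Φ₀ ∘ e)(ballPk r)` is bounded. [folklore] -/
theorem isBounded_factorCoords_image_ballPk (j : T.Label) {r : ℝ} (hr : 0 ≤ r) :
    IsBounded (P.factorCoords j '' P.ballPk j r) := by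
  rw [factorCoords_image_ballPk P j hr]
  refine isBounded_iff_forall_norm_le.2 ⟨max r 0, fun y hy => (pi_norm_le_iff_of_nonneg (le_max_right _ _)).2
    fun s => (hy s).trans (le_max_left _ _)⟩

/-- **ABSORPTION**: every bounded subset of `⊕_{(w,ε)} ℂ` lies in a polydisc of common positive radius. [folklore] -/
theorem exists_polydisc_of_isBounded {S : Set (J vQ j → ℂ)} (hS : IsBounded S) :
    ∃ r : ℝ, 0 < r ∧ S ⊆ polydisc (J vQ j) fun _ => r := by
  obtain ⟨R, hR⟩ := isBounded_iff_forall_norm_le.1 hS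
  refine ⟨max R 1, lt_of_lt_of_le one_pos (le_max_right _ _), fun y hy s => ?_⟩
  exact (norm_le_pi_norm y s).trans ((hR y hy).trans (le_max_left _ _))

/-- Hence the pull-back of a bounded family of Θ-boxes lies in some `ballPk r`, `r > 0`. [folklore] -/
theorem preimage_subset_ballPk_of_isBounded (j : T.Label) {S : Set (J vQ j → ℂ)} (hS : IsBounded S) :
    ∃ r : ℝ, 0 < r ∧ P.factorCoords j ⁻¹' S ⊆ P.ballPk j r := by
  obtain ⟨r, hr, hSr⟩ := exists_polydisc_of_isBounded (vQ := vQ) hS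
  exact ⟨r, hr, by rw [ballPk_eq_preimage_polydisc P j hr.le]; exact Set.preimage_mono hSr⟩

/-! ## 2. Descent: the comparison intertwines the generators with maps fixing `r·B_I` -/

/-- **The comparison intertwines a capsule permutation with the re-indexing of `M_I`**: `e(σ·x) = σ(e(x))`.
[cite: DupuyHilado2025, §4.7] -/
theorem comparison_permute (σ : Equiv.Perm (T.Caps j)) (x : L.Packet j vQ) :
    P.comparison j (L.permute j vQ σ x) = reindexEquiv vQ j σ (P.comparison j x) := by
  have key : P.comparison j ∘ₗ (L.permute j vQ σ).toLinearMap =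
      ((reindexEquiv vQ j σ).toLinearMap.restrictScalars ℚ) ∘ₗ P.comparison j := by
    refine PiTensorProduct.ext (MultilinearMap.ext fun y => ?_)
    simp only [LinearMap.compMultilinearMap_apply]
    change P.comparison j (L.permute j vQ σ (L.tprod j vQ y)) = reindexEquiv vQ j σ (P.comparison j (tprod ℚ y))
    rw [L.permute_tprod]
    change P.comparison j (tprod ℚ fun i => y (σ.symm i)) = _
    rw [comparison_tprod, comparison_tprod, reindexEquiv_tprod]
  exact LinearMap.congr_fun key x

/-- **The comparison intertwines a factor-and-summand-wise family acting by isometries `τ_{i,v}` of `ℂ` with L5-t7's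
induced automorphism**: `e(⊗_i ⊕_v g_{i,v}·x) = (⊗_i ⊕_v τ_{i,v})(e(x))`. [claim: Mochizuki2012, status: disputed] -/
theorem comparison_factorwise (g : T.Caps j → ∀ v : T.Fibre vQ, L.carrier v.1 ≃ₗ[ℚ] L.carrier v.1)
    (τ : T.Caps j → T.Fibre vQ → (ℂ ≃ₗᵢ[ℝ] ℂ)) (hτ : ∀ i v x, P.φ v (g i v x) = τ i v (P.φ v x))
    (x : L.Packet j vQ) :
    P.comparison j (L.factorwise j vQ (fun i => L.summandwise vQ (g i)) x) =
      induced (T.Caps j) (T.Fibre vQ) τ (P.comparison j x) := by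
  have key : P.comparison j ∘ₗ (L.factorwise j vQ (fun i => L.summandwise vQ (g i))).toLinearMap =
      ((induced (T.Caps j) (T.Fibre vQ) τ).restrictScalars ℚ) ∘ₗ P.comparison j := by
    refine PiTensorProduct.ext (MultilinearMap.ext fun y => ?_)
    simp only [LinearMap.compMultilinearMap_apply]
    change P.comparison j (L.factorwise j vQ (fun i => L.summandwise vQ (g i)) (L.tprod j vQ y)) =
      induced (T.Caps j) (T.Fibre vQ) τ (P.comparison j (tprod ℚ y))
    rw [L.factorwise_summandwise_tprod]
    change P.comparison j (tprod ℚ fun i => fun v => g i v (y i v)) = _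
    rw [comparison_tprod, comparison_tprod, induced_tprod]
    exact congrArg _ (funext fun a => funext fun v => by rw [onSummands_apply, hτ])
  exact LinearMap.congr_fun key x

/-- Images of scaled sets under maps commuting with real scaling. [folklore] -/
private theorem image_smul_of_map_smul {f : X vQ j → X vQ j} (hf : ∀ (c : ℝ) (x : X vQ j), f (c • x) = c • f x)
    (c : ℝ) (S : Set (X vQ j)) : f '' (c • S) = c • (f '' S) := by
  ext y
  constructor
  · rintro ⟨x, ⟨x', hx', rfl⟩, rfl⟩
    exact ⟨f x', ⟨x', hx', rfl⟩, (hf c x').symm⟩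
  · rintro ⟨y', ⟨x', hx', rfl⟩, rfl⟩
    exact ⟨c • x', ⟨x', hx', rfl⟩, hf c x'⟩

/-- **Re-indexing maps `B_I` onto itself** (it preserves the canonical decomposition up to a permutation of the
copies and isometries of `ℂ`: p417640 `preservesDecomposition_reindex`). [claim: Mochizuki2012, status: disputed] -/
theorem reindexEquiv_image_ball (σ : Equiv.Perm (T.Caps j)) :
    reindexEquiv vQ j σ '' ball (Φ₀ vQ j) = ball (Φ₀ vQ j) := by
  obtain ⟨e, u, h⟩ := preservesDecomposition_reindex (vQ := vQ) (j := j) σ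
  have hmem : ∀ x : X vQ j, reindexEquiv vQ j σ x ∈ ball (Φ₀ vQ j) ↔ x ∈ ball (Φ₀ vQ j) := by
    intro x
    simp only [ball, Set.mem_setOf_eq]
    constructor
    · intro hx k
      have := hx (e k)
      rw [← LinearEquiv.coe_coe, h x k, LinearIsometryEquiv.norm_map] at this
      exact this
    · intro hx k'
      obtain ⟨k, rfl⟩ := e.surjective k'
      rw [← LinearEquiv.coe_coe, h x k, LinearIsometryEquiv.norm_map]
      exact hx k
  ext y
  constructor
  · rintro ⟨x, hx, rfl⟩
    exact (hmem x).2 hx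
  · intro hy
    exact ⟨(reindexEquiv vQ j σ).symm y, (hmem _).1 (by simpa using hy), LinearEquiv.apply_symm_apply _ y⟩

/-- Re-indexing maps `r·B_I` onto itself. [claim: Mochizuki2012, status: disputed] -/
theorem reindexEquiv_image_smul_ball (σ : Equiv.Perm (T.Caps j)) (r : ℝ) :
    reindexEquiv vQ j σ '' (r • ball (Φ₀ vQ j)) = r • ball (Φ₀ vQ j) := by
  rw [image_smul_of_map_smul (fun c x => map_smul (reindexEquiv vQ j σ) c x), reindexEquiv_image_ball]

/-- L5-t7's induced automorphisms map `r·B_I` onto itself ([IUTchIV] Prop. 1.5 (iii): "`B_I ⊆ M_I` [is]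
preserved"; `image_ball_induced`). [claim: Mochizuki2012, status: disputed] -/
theorem induced_image_smul_ball (τ : T.Caps j → T.Fibre vQ → (ℂ ≃ₗᵢ[ℝ] ℂ)) (r : ℝ) :
    induced (T.Caps j) (T.Fibre vQ) τ '' (r • ball (Φ₀ vQ j)) = r • ball (Φ₀ vQ j) := by
  classical
  rw [image_smul_of_map_smul (fun c x => map_smul (induced (T.Caps j) (T.Fibre vQ) τ) c x),
    image_ball_induced]

/-! ## 3. Every (Ind1)/(Ind2)-family maps `e⁻¹(r·B_I)` onto itself -/

/-- `permute σ` maps `ballPk r` onto itself. [cite: DupuyHilado2025, §4.7] -/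
theorem permute_image_ballPk (σ : Equiv.Perm (T.Caps j)) (r : ℝ) :
    L.permute j vQ σ '' P.ballPk j r = P.ballPk j r :=
  image_preimage_eq_of_semiconj (L.permute j vQ σ).surjective (reindexEquiv vQ j σ).injective
    (P.comparison_permute σ) (reindexEquiv_image_smul_ball σ r)

/-- A factor-and-summand-wise family acting by isometries of `ℂ` maps `ballPk r` onto itself.
[claim: Mochizuki2012, status: disputed] -/
theorem factorwise_image_ballPk (g : T.Caps j → ∀ v : T.Fibre vQ, L.carrier v.1 ≃ₗ[ℚ] L.carrier v.1)
    (τ : T.Caps j → T.Fibre vQ → (ℂ ≃ₗᵢ[ℝ] ℂ)) (hτ : ∀ i v x, P.φ v (g i v x) = τ i v (P.φ v x)) (r : ℝ) :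
    L.factorwise j vQ (fun i => L.summandwise vQ (g i)) '' P.ballPk j r = P.ballPk j r :=
  image_preimage_eq_of_semiconj (LinearEquiv.surjective _) (inducedEquiv τ).injective
    (P.comparison_factorwise g τ hτ) (induced_image_smul_ball τ r)

/-- **(Ind2) maps `e⁻¹(r·B_I)` onto itself** (the order-2 automorphisms act by isometries).
[claim: Mochizuki2012, status: disputed] -/
theorem ism_image_ballPk (g : T.Caps j → ∀ v : T.Fibre vQ, L.carrier v.1 ≃ₗ[ℚ] L.carrier v.1)
    (hg : ∀ i v, g i v ∈ L.ism v.1) (r : ℝ) :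
    L.factorwise j vQ (fun i => L.summandwise vQ (g i)) '' P.ballPk j r = P.ballPk j r := by
  choose τ hτ using fun i v => P.ism_isometry v (g i v) (hg i v)
  exact P.factorwise_image_ballPk g τ hτ r

/-- **The strip part of (Ind1) maps `e⁻¹(r·B_I)` onto itself.** [claim: Mochizuki2012, status: disputed] -/
theorem strip_image_ballPk (g : T.Caps j → ∀ v : T.Fibre vQ, L.carrier v.1 ≃ₗ[ℚ] L.carrier v.1)
    (hg : ∀ i v, g i v ∈ L.stripAut v.1) (r : ℝ) :
    L.factorwise j vQ (fun i => L.summandwise vQ (g i)) '' P.ballPk j r = P.ballPk j r := by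
  choose τ hτ using fun i v => P.strip_isometry v (g i v) (hg i v)
  exact P.factorwise_image_ballPk g τ hτ r

/-- **Every (Ind1)- or (Ind2)-FAMILY of c312-1 maps `e⁻¹(r·B_I)` onto itself at `(j, ∞)`** — the hypothesis `hW`
of c312-7's `hullDefined_of_stable` at the archimedean place ([IUTchIV] Step (vii) p. 30 "`B_I ⊆ M_I` is
preserved by arbitrary automorphisms of the type discussed in Proposition 1.5, (iii)").
[claim: Mochizuki2012, status: disputed] -/
theorem family_image_ballPk {Φ : L.PacketAut} (hΦ : Φ ∈ L.Ind1Family ∪ L.Ind2Family) (j : T.Label) (r : ℝ) :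
    Φ j vQ '' P.ballPk j r = P.ballPk j r := by
  rcases hΦ with hΦ | hΦ
  · obtain ⟨σ, h, hh, hΦj⟩ := hΦ j
    have hΦj' : Φ j vQ = (L.permute j vQ σ).trans
        (L.factorwise j vQ fun i => L.summandwise vQ fun v : T.Fibre vQ => h i v.1) := hΦj vQ
    have hcomp : (⇑(Φ j vQ) : L.Packet j vQ → L.Packet j vQ) =
        ⇑(L.factorwise j vQ fun i => L.summandwise vQ fun v : T.Fibre vQ => h i v.1) ∘ ⇑(L.permute j vQ σ) := by
      rw [hΦj']; rfl
    rw [hcomp, Set.image_comp, P.permute_image_ballPk σ r]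
    exact P.strip_image_ballPk (fun i v => h i v.1) (fun i v => hh i v.1) r
  · obtain ⟨g, hg, hΦj⟩ := hΦ j vQ
    rw [hΦj]
    exact P.ism_image_ballPk g hg r

/-- Hence every element of the indeterminacy subgroup `⟨Ind1Family ∪ Ind2Family⟩` maps `e⁻¹(r·B_I)` onto itself.
[claim: Mochizuki2012, status: disputed] -/
theorem image_ballPk_of_mem_closure {Φ : L.PacketAut}
    (hΦ : Φ ∈ Subgroup.closure (L.Ind1Family ∪ L.Ind2Family)) (j : T.Label) (r : ℝ) :
    Φ j vQ '' P.ballPk j r = P.ballPk j r := by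
  induction hΦ using Subgroup.closure_induction with
  | mem Ψ hΨ => exact P.family_image_ballPk hΨ j r
  | one => simp
  | mul Ψ₁ Ψ₂ _ _ ih₁ ih₂ =>
    have hcomp : ⇑((Ψ₁ * Ψ₂) j vQ) = ⇑(Ψ₁ j vQ) ∘ ⇑(Ψ₂ j vQ) := by
      funext x
      rfl
    rw [hcomp, Set.image_comp, ih₂, ih₁]
  | inv Ψ _ ih =>
    change ⇑((Ψ j vQ).symm) '' P.ballPk j r = P.ballPk j r
    conv_lhs => rw [← ih]
    rw [Set.image_image]
    simp only [LinearEquiv.symm_apply_apply, Set.image_id']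

end ArchPresentation

end Cor312Vol

end IUTFork

end Summit.ABC

end
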